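import Mathlib

/-!
# The double-coset invariant `κ` of two orthogonal tori in a rank-two unitary group (support, seat p1)

Explicit coordinates, any field `E` with a ring involution `σ`. The hermitian plane is `E²` with the form
`h(x, y) = d₀ x₀ σ(y₀) + d₁ x₁ σ(y₁)` (`d i` non-zero and `σ`-fixed: the first orthogonal basis `e₀, e₁` with
`h(e_i, e_i) = d i`); a second orthogonal basis `f 0, f 1` (`h(f 0, f 1) = 0`, `h(f j, f j) = d' j ≠ 0`) gives the
second torus. For an isometry `γ` the entries `c i j = h(γ f_j, e_i) = d i · (γ f_j)_i` satisfy the Gram relations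
`∑_i c i j σ(c i k) / d i = h(f j, f k)`, and the single invariant

  `κ(γ) = N(c 0 0) / (d 0 · d' 0)`,  `N(x) = x σ(x)`,

determines all four norms: `N(c 1 0) = (1 − κ) d 1 d' 0`, `N(c 0 1) = (1 − κ) d 0 d' 1`, `N(c 1 1) = κ d 1 d' 1`.
Under the two tori — `T_A` = the diagonal matrices `diagonal a` with `N(a i) = 1` (the stabiliser of the lines
`E e₀, E e₁`) and `T_B` = the matrices `t'` with `t' f_j = b j f_j`, `N(b j) = 1` — one has
`c i j (diagonal a * γ * t') = a i · b j · c i j (γ)`, so `κ` is constant on double cosets `T_A γ T_B`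
(`kappa_diag_mul`). MAIN THEOREM (`exists_double_coset_of_kappa_eq`): two isometries `γ, γ'` with the same
REGULAR invariant `κ ∉ {0, 1}` lie in the same double coset — on the basis `f`, `γ' f_j = (diagonal a * γ)(b j • f_j)`
for explicit `a, b` of norm one; with `P = [f 0 | f 1]` invertible (`isUnit_det_of_orth`: automatic for an orthogonal
basis of non-isotropic vectors) this is `γ' = diagonal a * γ * t'` with `t' = P · diagonal b · P⁻¹ ∈ T_B`
(`exists_double_coset_matrix_of_kappa_eq`, in the companion module `T7SupportTwoTorusMatrix`). The fibre of `κ`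
over a regular value is therefore ONE double coset (no finite ambiguity), by elementary algebra.

Pure algebra over a field with an involution; nothing here is about any adelic group, any automorphic
representation, or any period. Blind lane: Mathlib only; no sorry; axioms ⊆ {propext, Classical.choice, Quot.sound}.
-/

namespace Summit.Ventures.HodgeRepro2.T7SupportTwoTorusInvariant

open Matrix

variable {E : Type*} [Field E] (σ : E →+* E)

/-- the norm `N(x) = x · σ(x)` of the involution -/
def nrm (x : E) : E := x * σ x

/-- the hermitian form `h(x, y) = d₀ x₀ σ(y₀) + d₁ x₁ σ(y₁)` (the first basis is orthogonal with `h(e_i, e_i) = d i`) -/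
def herm (d : Fin 2 → E) (x y : Fin 2 → E) : E := ∑ i, d i * (x i * σ (y i))

/-- `γ` is an isometry of `h` -/
def IsIsom (d : Fin 2 → E) (γ : Matrix (Fin 2) (Fin 2) E) : Prop :=
  ∀ x y, herm σ d (γ *ᵥ x) (γ *ᵥ y) = herm σ d x y

/-- the entries `c i j = h(γ f_j, e_i) = d i · (γ f_j)_i` of `γ` against the two bases -/
def cc (d : Fin 2 → E) (f : Fin 2 → Fin 2 → E) (γ : Matrix (Fin 2) (Fin 2) E) (i j : Fin 2) : E :=
  d i * (γ *ᵥ f j) i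

/-- the discriminants `d' j = h(f j, f j)` of the second basis -/
def disc' (d : Fin 2 → E) (f : Fin 2 → Fin 2 → E) (j : Fin 2) : E := herm σ d (f j) (f j)

/-- the double-coset invariant `κ(γ) = N(c 0 0) / (d 0 · d' 0)` -/
def kappa (d : Fin 2 → E) (f : Fin 2 → Fin 2 → E) (γ : Matrix (Fin 2) (Fin 2) E) : E :=
  nrm σ (cc d f γ 0 0) / (d 0 * disc' σ d f 0)

/-- `t'` acts on the second basis by the scalars `b` (membership in the second torus, eigenvalues `b`) -/
def ActsOn (f : Fin 2 → Fin 2 → E) (t' : Matrix (Fin 2) (Fin 2) E) (b : Fin 2 → E) : Prop :=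
  ∀ j, t' *ᵥ f j = b j • f j

/-! ## 1. Elementary lemmas -/

/-- a `2 × 2` matrix–vector product, entrywise -/
theorem mulVec_two (M : Matrix (Fin 2) (Fin 2) E) (x : Fin 2 → E) (i : Fin 2) :
    (M *ᵥ x) i = M i 0 * x 0 + M i 1 * x 1 := by
  simp [Matrix.mulVec, dotProduct, Fin.sum_univ_two]

/-- the hermitian form written out -/
theorem herm_eq (d : Fin 2 → E) (x y : Fin 2 → E) :
    herm σ d x y = d 0 * (x 0 * σ (y 0)) + d 1 * (x 1 * σ (y 1)) := by
  simp [herm, Fin.sum_univ_two]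

/-- the norm is multiplicative -/
theorem nrm_mul (x y : E) : nrm σ (x * y) = nrm σ x * nrm σ y := by
  simp only [nrm, map_mul]; ring

/-- `N(1) = 1` -/
theorem nrm_one : nrm σ (1 : E) = 1 := by simp [nrm]

/-- the norm of a quotient -/
theorem nrm_div (x y : E) : nrm σ (x / y) = nrm σ x / nrm σ y := by
  simp only [nrm, map_div₀]; ring

/-- the norm of a negative -/
theorem nrm_neg (x : E) : nrm σ (-x) = nrm σ x := by simp [nrm]

/-- `N(σ x) = N(x)` for an involution -/
theorem nrm_sigma (hσ : ∀ x, σ (σ x) = x) (x : E) : nrm σ (σ x) = nrm σ x := by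
  simp only [nrm, hσ]; ring

/-- `N(x) = 0` iff `x = 0` (an involution is injective) -/
theorem nrm_eq_zero_iff (hσ : ∀ x, σ (σ x) = x) (x : E) : nrm σ x = 0 ↔ x = 0 := by
  constructor
  · intro h
    rcases mul_eq_zero.1 h with h | h
    · exact h
    · have := congrArg σ h
      rw [hσ, map_zero] at this
      exact this
  · rintro rfl
    simp [nrm]

/-- the norm of a non-zero element is non-zero -/
theorem nrm_ne_zero (hσ : ∀ x, σ (σ x) = x) {x : E} (hx : x ≠ 0) : nrm σ x ≠ 0 :=
  fun h => hx ((nrm_eq_zero_iff σ hσ x).1 h)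

/-- `σ(x) = x⁻¹` for a norm-one element -/
theorem sigma_eq_inv_of_nrm_eq_one {x : E} (hx : nrm σ x = 1) : σ x = x⁻¹ := by
  have hx0 : x ≠ 0 := by
    rintro rfl
    simp [nrm] at hx
  have : x * σ x = 1 := hx
  field_simp
  linear_combination this

/-- the Gram-type entries of a product `diagonal a * γ * t'` with `t' f_j = b j f_j` -/
theorem cc_diag_mul (d : Fin 2 → E) (f : Fin 2 → Fin 2 → E) (γ t' : Matrix (Fin 2) (Fin 2) E)
    (a b : Fin 2 → E) (hb : ActsOn f t' b) (i j : Fin 2) :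
    cc d f (diagonal a * γ * t') i j = a i * b j * cc d f γ i j := by
  unfold cc
  rw [← Matrix.mulVec_mulVec, ← Matrix.mulVec_mulVec, hb j, Matrix.mulVec_smul,
    Matrix.mulVec_diagonal]
  simp only [Pi.smul_apply, smul_eq_mul]
  ring

/-! ## 2. The Gram relations of an isometry -/

/-- `∑_i c i j σ(c i k) / d i = h(f j, f k)` for an isometry `γ` -/
theorem gram (d : Fin 2 → E) (hd : ∀ i, σ (d i) = d i) (hd0 : ∀ i, d i ≠ 0)
    (f : Fin 2 → Fin 2 → E) (γ : Matrix (Fin 2) (Fin 2) E) (hγ : IsIsom σ d γ) (j k : Fin 2) :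
    cc d f γ 0 j * σ (cc d f γ 0 k) / d 0 + cc d f γ 1 j * σ (cc d f γ 1 k) / d 1 =
      herm σ d (f j) (f k) := by
  have h := hγ (f j) (f k)
  rw [herm_eq] at h
  rw [← h]
  unfold cc
  simp only [map_mul, hd]
  have h0 := hd0 0
  have h1 := hd0 1
  field_simp

/-- the norm relations determined by `κ`: `N(c 1 0) = (1 − κ) d 1 d' 0` -/
theorem nrm_cc_one_zero (d : Fin 2 → E) (hd : ∀ i, σ (d i) = d i) (hd0 : ∀ i, d i ≠ 0)
    (f : Fin 2 → Fin 2 → E) (hf0 : disc' σ d f 0 ≠ 0)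
    (γ : Matrix (Fin 2) (Fin 2) E) (hγ : IsIsom σ d γ) :
    nrm σ (cc d f γ 1 0) = (1 - kappa σ d f γ) * d 1 * disc' σ d f 0 := by
  have hg := gram σ d hd hd0 f γ hγ 0 0
  have h0 := hd0 0
  have h1 := hd0 1
  have hg' : nrm σ (cc d f γ 0 0) * d 1 + nrm σ (cc d f γ 1 0) * d 0 =
      disc' σ d f 0 * (d 0 * d 1) := by
    unfold nrm disc'
    rw [div_add_div _ _ h0 h1, div_eq_iff (mul_ne_zero h0 h1)] at hg
    linear_combination hg
  unfold kappa
  field_simp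
  linear_combination hg'

/-- the norm relations determined by `κ`: `N(c 0 1) = (1 − κ) d 0 d' 1` -/
theorem nrm_cc_zero_one (hσ : ∀ x, σ (σ x) = x) (d : Fin 2 → E) (hd : ∀ i, σ (d i) = d i)
    (hd0 : ∀ i, d i ≠ 0) (f : Fin 2 → Fin 2 → E) (hf : herm σ d (f 0) (f 1) = 0)
    (hf0 : disc' σ d f 0 ≠ 0) (γ : Matrix (Fin 2) (Fin 2) E) (hγ : IsIsom σ d γ) :
    nrm σ (cc d f γ 0 1) = (1 - kappa σ d f γ) * d 0 * disc' σ d f 1 := by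
  -- the three Gram relations
  have g00 := gram σ d hd hd0 f γ hγ 0 0
  have g11 := gram σ d hd hd0 f γ hγ 1 1
  have g01 := gram σ d hd hd0 f γ hγ 0 1
  rw [hf] at g01
  have h0 := hd0 0
  have h1 := hd0 1
  -- abbreviations
  set c00 := cc d f γ 0 0 with hc00
  set c10 := cc d f γ 1 0 with hc10
  set c01 := cc d f γ 0 1 with hc01
  set c11 := cc d f γ 1 1 with hc11
  -- the norm of the orthogonality relation: `N(c10) N(c11) / d1² = N(c00) N(c01) / d0²`
  have hN : c10 * σ c10 * (c11 * σ c11) * (d 0 * d 0) = c00 * σ c00 * (c01 * σ c01) * (d 1 * d 1) := by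
    have e : c10 * σ c11 * d 0 = -(c00 * σ c01 * d 1) := by
      field_simp at g01
      linear_combination g01
    have e' : σ c10 * c11 * d 0 = -(σ c00 * c01 * d 1) := by
      have := congrArg σ e
      simp only [map_mul, map_neg, hσ, hd] at this
      exact this
    linear_combination (σ c10 * c11 * d 0) * e + (-(c00 * σ c01 * d 1)) * e'
  -- `κ` in terms of the norms
  have hk : kappa σ d f γ * (d 0 * disc' σ d f 0) = c00 * σ c00 := by
    unfold kappa nrm
    rw [← hc00]
    field_simp
  have hk10 : c10 * σ c10 = (1 - kappa σ d f γ) * d 1 * disc' σ d f 0 :=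
    nrm_cc_one_zero σ d hd hd0 f hf0 γ hγ
  unfold nrm
  unfold disc' at hk hk10 hf0 ⊢
  -- `X + Y = d'₁` and `(1 − κ) Y = κ X` with `X = N(c01)/d0`, `Y = N(c11)/d1`
  have hsum : c01 * σ c01 * d 1 + c11 * σ c11 * d 0 = herm σ d (f 1) (f 1) * (d 0 * d 1) := by
    field_simp at g11
    linear_combination g11
  have hcross : (1 - kappa σ d f γ) * (c11 * σ c11) * d 0 = kappa σ d f γ * (c01 * σ c01) * d 1 := by
    have hne : herm σ d (f 0) (f 0) * (d 0 * d 1) ≠ 0 := by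
      exact mul_ne_zero hf0 (mul_ne_zero h0 h1)
    apply mul_right_cancel₀ hne
    linear_combination hN - (c11 * σ c11 * d 0 ^ 2) * hk10 - (c01 * σ c01 * d 1 ^ 2) * hk
  apply mul_right_cancel₀ h1
  apply mul_right_cancel₀ h0
  linear_combination (d 0 * (1 - kappa σ d f γ)) * hsum - (d 0) * hcross

/-- the norm relations determined by `κ`: `N(c 1 1) = κ d 1 d' 1` -/
theorem nrm_cc_one_one (hσ : ∀ x, σ (σ x) = x) (d : Fin 2 → E) (hd : ∀ i, σ (d i) = d i)
    (hd0 : ∀ i, d i ≠ 0) (f : Fin 2 → Fin 2 → E) (hf : herm σ d (f 0) (f 1) = 0)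
    (hf0 : disc' σ d f 0 ≠ 0) (γ : Matrix (Fin 2) (Fin 2) E) (hγ : IsIsom σ d γ) :
    nrm σ (cc d f γ 1 1) = kappa σ d f γ * d 1 * disc' σ d f 1 := by
  have g11 := gram σ d hd hd0 f γ hγ 1 1
  have h01 := nrm_cc_zero_one σ hσ d hd hd0 f hf hf0 γ hγ
  have h0 := hd0 0
  have h1 := hd0 1
  unfold nrm at h01 ⊢
  unfold disc' at h01 ⊢
  field_simp at g11
  apply mul_right_cancel₀ h1
  apply mul_right_cancel₀ h0
  linear_combination (d 1) * g11 - (d 1 ^ 2) * h01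

/-! ## 3. `κ` is a double-coset invariant -/

/-- **`κ` is a double-coset invariant**: `κ(diagonal a * γ * t') = κ(γ)` for `N(a 0) = N(b 0) = 1`, `t' ∈ T_B` -/
theorem kappa_diag_mul (d : Fin 2 → E) (f : Fin 2 → Fin 2 → E) (γ t' : Matrix (Fin 2) (Fin 2) E)
    (a b : Fin 2 → E) (ha : nrm σ (a 0) = 1) (hb0 : nrm σ (b 0) = 1) (hb : ActsOn f t' b) :
    kappa σ d f (diagonal a * γ * t') = kappa σ d f γ := by
  unfold kappa
  rw [cc_diag_mul d f γ t' a b hb, nrm_mul, nrm_mul, ha, hb0]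
  ring

/-! ## 4. The separation theorem: a regular `κ` determines the double coset -/

/-- **`κ` separates regular double cosets** (on the second basis). Two isometries with the same invariant
`κ ∉ {0, 1}` satisfy `γ' f_j = (diagonal a * γ)(b j • f_j)` for norm-one scalars `a`, `b`. -/
theorem exists_double_coset_of_kappa_eq (hσ : ∀ x, σ (σ x) = x) (d : Fin 2 → E)
    (hd : ∀ i, σ (d i) = d i) (hd0 : ∀ i, d i ≠ 0) (f : Fin 2 → Fin 2 → E)
    (hf : herm σ d (f 0) (f 1) = 0) (hf0 : disc' σ d f 0 ≠ 0) (hf1 : disc' σ d f 1 ≠ 0)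
    (γ γ' : Matrix (Fin 2) (Fin 2) E) (hγ : IsIsom σ d γ) (hγ' : IsIsom σ d γ')
    (hκ : kappa σ d f γ' = kappa σ d f γ) (hκ0 : kappa σ d f γ ≠ 0) (hκ1 : kappa σ d f γ ≠ 1) :
    ∃ a b : Fin 2 → E, (∀ i, nrm σ (a i) = 1) ∧ (∀ j, nrm σ (b j) = 1) ∧
      ∀ j, γ' *ᵥ f j = (diagonal a * γ) *ᵥ (b j • f j) := by
  have h0 := hd0 0
  have h1 := hd0 1
  have hK1 : 1 - kappa σ d f γ ≠ 0 := sub_ne_zero.2 (Ne.symm hκ1)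
  -- the norms of the entries of γ and γ'
  have n00 : nrm σ (cc d f γ 0 0) = kappa σ d f γ * d 0 * disc' σ d f 0 := by
    unfold kappa; field_simp
  have n00' : nrm σ (cc d f γ' 0 0) = kappa σ d f γ * d 0 * disc' σ d f 0 := by
    rw [← hκ]; unfold kappa; field_simp
  have n10 := nrm_cc_one_zero σ d hd hd0 f hf0 γ hγ
  have n10' := nrm_cc_one_zero σ d hd hd0 f hf0 γ' hγ'
  have n01 := nrm_cc_zero_one σ hσ d hd hd0 f hf hf0 γ hγ
  have n01' := nrm_cc_zero_one σ hσ d hd hd0 f hf hf0 γ' hγ'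
  have n11 := nrm_cc_one_one σ hσ d hd hd0 f hf hf0 γ hγ
  have n11' := nrm_cc_one_one σ hσ d hd hd0 f hf hf0 γ' hγ'
  rw [hκ] at n10' n01' n11'
  -- every entry is non-zero
  have hc : ∀ c : E, nrm σ c ≠ 0 → c ≠ 0 := fun c hc hc0 => hc (by rw [hc0]; simp [nrm])
  have c00 : cc d f γ 0 0 ≠ 0 := hc _ (by rw [n00]; exact mul_ne_zero (mul_ne_zero hκ0 h0) hf0)
  have c00' : cc d f γ' 0 0 ≠ 0 := hc _ (by rw [n00']; exact mul_ne_zero (mul_ne_zero hκ0 h0) hf0)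
  have c10 : cc d f γ 1 0 ≠ 0 := hc _ (by rw [n10]; exact mul_ne_zero (mul_ne_zero hK1 h1) hf0)
  have c10' : cc d f γ' 1 0 ≠ 0 := hc _ (by rw [n10']; exact mul_ne_zero (mul_ne_zero hK1 h1) hf0)
  have c01 : cc d f γ 0 1 ≠ 0 := hc _ (by rw [n01]; exact mul_ne_zero (mul_ne_zero hK1 h0) hf1)
  have c01' : cc d f γ' 0 1 ≠ 0 := hc _ (by rw [n01']; exact mul_ne_zero (mul_ne_zero hK1 h0) hf1)
  have c11 : cc d f γ 1 1 ≠ 0 := hc _ (by rw [n11]; exact mul_ne_zero (mul_ne_zero hκ0 h1) hf1)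
  -- the scalars
  set b0 : E := cc d f γ' 0 0 / cc d f γ 0 0 with hb0
  set b1 : E := cc d f γ' 0 1 / cc d f γ 0 1 with hb1
  set a1 : E := cc d f γ' 1 0 / (b0 * cc d f γ 1 0) with ha1
  have hb0ne : b0 ≠ 0 := div_ne_zero c00' c00
  have hb1ne : b1 ≠ 0 := div_ne_zero c01' c01
  have ha1ne : a1 ≠ 0 := div_ne_zero c10' (mul_ne_zero hb0ne c10)
  have hb0n : nrm σ b0 = 1 := by
    rw [hb0, nrm_div, n00', n00]; field_simp
  have hb1n : nrm σ b1 = 1 := by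
    rw [hb1, nrm_div, n01', n01]; field_simp
  have ha1n : nrm σ a1 = 1 := by
    rw [ha1, nrm_div, nrm_mul, hb0n, n10', n10]; field_simp
  -- the (1,1)-entry: the orthogonality relations of γ and γ'
  have key : cc d f γ' 1 1 = a1 * b1 * cc d f γ 1 1 := by
    have g01 := gram σ d hd hd0 f γ hγ 0 1
    have g01' := gram σ d hd hd0 f γ' hγ' 0 1
    rw [hf] at g01 g01'
    -- the relations with cleared denominators, and their σ-conjugates
    have e : cc d f γ 1 0 * σ (cc d f γ 1 1) * d 0 = -(cc d f γ 0 0 * σ (cc d f γ 0 1) * d 1) := by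
      field_simp at g01; linear_combination g01
    have e' : cc d f γ' 1 0 * σ (cc d f γ' 1 1) * d 0 =
        -(cc d f γ' 0 0 * σ (cc d f γ' 0 1) * d 1) := by
      field_simp at g01'; linear_combination g01'
    have eσ : σ (cc d f γ 1 0) * cc d f γ 1 1 * d 0 =
        -(σ (cc d f γ 0 0) * cc d f γ 0 1 * d 1) := by
      have := congrArg σ e
      simp only [map_mul, map_neg, hσ, hd] at this
      exact this
    have eσ' : σ (cc d f γ' 1 0) * cc d f γ' 1 1 * d 0 =
        -(σ (cc d f γ' 0 0) * cc d f γ' 0 1 * d 1) := by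
      have := congrArg σ e'
      simp only [map_mul, map_neg, hσ, hd] at this
      exact this
    -- the two norm equalities
    have hN0 : cc d f γ' 0 0 * σ (cc d f γ' 0 0) = cc d f γ 0 0 * σ (cc d f γ 0 0) := by
      have := n00'.trans n00.symm
      simpa [nrm] using this
    have hN1 : cc d f γ' 1 0 * σ (cc d f γ' 1 0) = cc d f γ 1 0 * σ (cc d f γ 1 0) := by
      have := n10'.trans n10.symm
      simpa [nrm] using this
    -- the cleared form of the claim
    have hs10 : σ (cc d f γ 1 0) ≠ 0 := fun h => c10 (by rw [← hσ (cc d f γ 1 0), h, map_zero])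
    have hs10' : σ (cc d f γ' 1 0) ≠ 0 := fun h => c10' (by rw [← hσ (cc d f γ' 1 0), h, map_zero])
    have hT : cc d f γ' 1 1 * cc d f γ' 0 0 * cc d f γ 1 0 * cc d f γ 0 1 =
        cc d f γ' 1 0 * cc d f γ' 0 1 * cc d f γ 1 1 * cc d f γ 0 0 := by
      have hne : d 0 * σ (cc d f γ 1 0) * σ (cc d f γ' 1 0) ≠ 0 :=
        mul_ne_zero (mul_ne_zero h0 hs10) hs10'
      apply mul_right_cancel₀ hne
      linear_combination
        (cc d f γ' 0 0 * cc d f γ 1 0 * cc d f γ 0 1 * σ (cc d f γ 1 0)) * eσ' -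
        (cc d f γ' 1 0 * cc d f γ' 0 1 * cc d f γ 0 0 * σ (cc d f γ' 1 0)) * eσ -
        (d 1 * cc d f γ' 0 1 * cc d f γ 0 1 * (cc d f γ 1 0 * σ (cc d f γ 1 0))) * hN0 +
        (d 1 * cc d f γ' 0 1 * cc d f γ 0 1 * (cc d f γ 0 0 * σ (cc d f γ 0 0))) * hN1
    rw [ha1, hb1, hb0]
    field_simp
    linear_combination hT
  -- assemble
  refine ⟨![1, a1], ![b0, b1], ?_, ?_, ?_⟩
  · intro i
    fin_cases i
    · simp [nrm_one]
    · simpa using ha1n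
  · intro j
    fin_cases j
    · simpa using hb0n
    · simpa using hb1n
  · intro j
    funext i
    -- compare the entries `c i j` : `(γ' f_j)_i = c' i j / d i`
    have hcc : ∀ (δ : Matrix (Fin 2) (Fin 2) E) (i j : Fin 2),
        (δ *ᵥ f j) i = cc d f δ i j / d i := by
      intro δ i j
      unfold cc
      field_simp [hd0 i]
    rw [hcc γ' i j, ← Matrix.mulVec_mulVec, Matrix.mulVec_smul, Matrix.mulVec_diagonal,
      Pi.smul_apply, smul_eq_mul, hcc γ i j]
    have hdi := hd0 i
    fin_cases i <;> fin_cases j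
    · change cc d f γ' 0 0 / d 0 = 1 * (b0 * (cc d f γ 0 0 / d 0))
      rw [hb0]; field_simp
    · change cc d f γ' 0 1 / d 0 = 1 * (b1 * (cc d f γ 0 1 / d 0))
      rw [hb1]; field_simp
    · change cc d f γ' 1 0 / d 1 = a1 * (b0 * (cc d f γ 1 0 / d 1))
      rw [ha1]; field_simp
    · change cc d f γ' 1 1 / d 1 = a1 * (b1 * (cc d f γ 1 1 / d 1))
      rw [key]; field_simp

end Summit.Ventures.HodgeRepro2.T7SupportTwoTorusInvariant
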